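/-
Copyright (c) 2026 the pub-hodgecm-mathlib formalisation cell (harness21).  Track B «K2-LIT» prover seat hodgecm-mathlib-K2E3-p15 (g3), 2026-09-04: U12 row 11, the `N = 3` SUPERCUSPIDAL branch,
re-pointed at the letter-neutral (M5h‴) head — Harish-Chandra's Theorem 16 for `U₃(H)(L⁺_v)` modulo «ELL-WEIGHT at the place» (deal (D56), K2E3-plan (g3)).
-/
import Summits.HodgeConjecture.HodgeConjecture.Theorems.K2E3SupercuspidalTruncatedCharAnalyticOfEllWeightPlace   -- ★ (M5h‴) p857163 (K2E5-p04 g3): `sigSCan_datum_of_ellWeightPlace` (the (SC-an) ∃-datum at N = 3 modulo «ELL-WEIGHT»)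
import Summits.HodgeConjecture.HodgeConjecture.Theorems.K2E3CharLocIntNearSemisimpleSupercuspidalOfTruncated    -- ★ p856184 (K2E3-p20 g3): `exists_rep_data_of_isSupercuspidal`, `charLocIntNearSemisimple_supercuspidal_of_exists_truncated`
import HarnessLib

/-!
# Row 11 at `N = 3`, supercuspidal classes: the character is a locally summable function near every semisimple point, MODULO «ELL-WEIGHT at the place»
# (Harish-Chandra 1970 Part VII Thm. 16; 1999 Thm. 16.1; Rogawski 1990 §12.2)

Cell `pub/hodgecm-mathlib`, crux H413 = `stmt-HodgeConjecture-24833` (supports-only, `--as helper`), Track B ENGINE E3, unit U12 «Characters», row 11 (`sig_K2E3CharLocIntNearSemisimple`),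
deal (D56) (K2E3-plan (g3) 03:56:07Z).  THE U12 ED. 11 RE-POINT HEAD for the `N = 3` supercuspidal branch: the tie ★ `U12Characters.charLocIntNearSemisimple_supercuspidal_of_sigSCan`
(`Lines/…U12Characters.lean` :265, sorry-free over the HOSTED socket (SC-an) `sig_K2E3SupercuspidalTruncatedCharAnalytic`) specialised to `N := 3` and re-sourced: instead of the (SC-an) socket it
consumes ★ (M5h‴) `K2E3SupercuspidalTruncatedCharAnalyticOfEllWeightPlace.sigSCan_datum_of_ellWeightPlace` (K2E5-p04 (g3) p857163), whose ONE named input is **«ELL-WEIGHT at the place»** — a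
locally integrable weight `W_E` on `U(σ_w, Φ₃)(L_w)` dominating the elliptic regular orbital integrals of every bounded Borel function supported in a compact set (paid by road A «HC-14-ell»
= Harish-Chandra's Theorem 14, or by road FC; K2E3-p14 (g4) lead).  So:
**`charLocIntNearSemisimple_supercuspidal_three_of_ellWeightPlace (hEW : ‹ELL-WEIGHT, ∀-closed — the `hEW` binder of ★ p857163 VERBATIM›) : ‹U12 :265's statement with N := 3, VERBATIM›`**
— for every hermitian `H ∈ M₃(L)` with `det H ≠ 0`, every non-split `v`, every Haar `μ`, every SUPERCUSPIDAL class `c` of `U(H)(L⁺_v)` and every semisimple `s`: an open `U ∋ s` and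
`Θ ∈ L¹(U, μ)` with `tr c(f) = ∫ f·Θ dμ` for all Schwartz–Bruhat `f` supported in `U` [HarishChandra1970 Part VII Thm. 16].  Proof = U12 :265's six lines with the (SC-an) call replaced:
★ `exists_rep_data_of_isSupercuspidal` (an admissible supercuspidal representative with an invariant positive-definite form), a non-zero vector, ★ `sigSCan_datum_of_ellWeightPlace`
(`Ω, F, M` with (SC-lim∖ell), (SC-dom), `M ∈ L¹_loc`), ★ `charLocIntNearSemisimple_supercuspidal_of_exists_truncated`.  When FC-8 `ellWeightPlace_of_finConj` (K2E3-p23 (g4)) lands, row 11's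
`N = 3` supercuspidal branch ties ★ in one line `charLocIntNearSemisimple_supercuspidal_three_of_ellWeightPlace ‹FC-8›`.
HONEST LABEL: `--supports stmt-HodgeConjecture-24833 --as helper`, count-neutral; CONDITIONAL on «ELL-WEIGHT at the place» (a hypothesis, not a socket here); HC_CM is proved only modulo the 7
printed citations (2 remaining named inputs: hLiu418 = `stmt-HodgeConjecture-24832`, h413 = `stmt-HodgeConjecture-24833`) until rung 0 closes.

## References
* [HarishChandra1970] Harish-Chandra, *Harmonic analysis on reductive p-adic groups* (notes by G. van Dijk), LNM 162 (1970), Part VII §3 Theorem 16 p. 67, pp. 70–73; Part VI §8 Theorem 14 p. 60.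
* [HarishChandra1999] Harish-Chandra, *Admissible invariant distributions on reductive p-adic groups* (notes by S. DeBacker, P. Sally), AMS ULS 16 (1999), Thm. 16.1 p. 77.
* [Rogawski1990] J. D. Rogawski, *Automorphic Representations of Unitary Groups in Three Variables*, Ann. of Math. Stud. 123 (1990), §12.2 p. 173, §12.5 p. 182.
-/

set_option autoImplicit false
set_option linter.dupNamespace false

noncomputable section

open MeasureTheory Measure Set NumberField IsDedekindDomain
open scoped NNReal ENNReal Pointwise Matrix MatrixGroups Valued
open Literature.NumberTheory.Rogawski1990 Literature.NumberTheory.Automorphic Literature.NumberTheory.Automorphic.UnitaryGroup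
open Literature.NumberTheory.Automorphic.UnitaryGroup.CotangentForms Literature.NumberTheory.GaloisRepresentations
open Literature.NumberTheory.GaloisRepresentations.IsNonarchimedeanLocalField

namespace Summit.HodgeConjecture.HodgeConjecture.Cruxes.H413.K2E3CharLocIntNearSemisimpleSupercuspidalThree

open Summit.HodgeConjecture.HodgeConjecture.Cruxes.H413

open Filter Topology Pointwise in
open scoped Classical in
/-- **ROW 11 AT `N = 3` FOR SUPERCUSPIDAL CLASSES, MODULO «ELL-WEIGHT AT THE PLACE»** — U12 :265 `charLocIntNearSemisimple_supercuspidal_of_sigSCan` with `N := 3` (statement otherwise VERBATIM),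
its (SC-an) input re-sourced to ★ (M5h‴) `sigSCan_datum_of_ellWeightPlace` under the hypothesis `hEW` (that theorem's binder VERBATIM): for `H ∈ M₃(L)` hermitian non-degenerate, `v` non-split,
`μ` Haar, `c` supercuspidal and `s` semisimple, the character of `c` is a locally integrable function on a neighbourhood of `s`.
[cite: HarishChandra1970, Part VII Thm 16 p. 67] [cite: HarishChandra1999, Thm 16.1 p. 77] [cite: Rogawski1990, §12.2 p. 173] -/
theorem charLocIntNearSemisimple_supercuspidal_three_of_ellWeightPlace
    (hEW : ∀ (L' : Type) [Field L'] [NumberField L'] [IsCMField L'] {v' : HeightOneSpectrum (𝓞 ↥(maximalRealSubfield L'))}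
      (w' : UnitaryGroup.PlacesOver L' v') (hw' : IsCMField.complexConj L' • w'.1 = w'.1)
      [MeasurableSpace ↥(unitaryGroupOfForm (galAdicCompletionMap (L := L') (IsCMField.complexConj L') hw') ((StdForm.antidiagonal 3).over (w'.1.adicCompletion L')))]
      [BorelSpace ↥(unitaryGroupOfForm (galAdicCompletionMap (L := L') (IsCMField.complexConj L') hw') ((StdForm.antidiagonal 3).over (w'.1.adicCompletion L')))]
      (μ' : Measure ↥(unitaryGroupOfForm (galAdicCompletionMap (L := L') (IsCMField.complexConj L') hw') ((StdForm.antidiagonal 3).over (w'.1.adicCompletion L')))) [μ'.IsHaarMeasure]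
      {S : Set ↥(unitaryGroupOfForm (galAdicCompletionMap (L := L') (IsCMField.complexConj L') hw') ((StdForm.antidiagonal 3).over (w'.1.adicCompletion L')))} (_ : IsCompact S),
      ∃ W_E : ↥(unitaryGroupOfForm (galAdicCompletionMap (L := L') (IsCMField.complexConj L') hw') ((StdForm.antidiagonal 3).over (w'.1.adicCompletion L'))) → ℝ,
        LocallyIntegrable W_E μ' ∧ (∀ g, 0 ≤ W_E g) ∧
        ∀ γ : ↥(unitaryGroupOfForm (galAdicCompletionMap (L := L') (IsCMField.complexConj L') hw') ((StdForm.antidiagonal 3).over (w'.1.adicCompletion L'))),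
          IsRegularElt (γ : GL (Fin 3) (w'.1.adicCompletion L')) →
          IsCompact ((Subgroup.centralizer ({γ} : Set ↥(unitaryGroupOfForm (galAdicCompletionMap (L := L') (IsCMField.complexConj L') hw') ((StdForm.antidiagonal 3).over (w'.1.adicCompletion L'))))) :
              Set ↥(unitaryGroupOfForm (galAdicCompletionMap (L := L') (IsCMField.complexConj L') hw') ((StdForm.antidiagonal 3).over (w'.1.adicCompletion L')))) →
            ∀ Θ : ↥(unitaryGroupOfForm (galAdicCompletionMap (L := L') (IsCMField.complexConj L') hw') ((StdForm.antidiagonal 3).over (w'.1.adicCompletion L'))) → ℝ≥0∞,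
              Measurable Θ → (∀ g, Θ g ≠ 0 → g ∈ S) → ∀ Mb : ℝ≥0∞, (∀ g, Θ g ≤ Mb) →
                ∫⁻ x, Θ (x * γ * x⁻¹) ∂μ' ≤ ENNReal.ofReal (W_E γ) * Mb) :
  ∀ (L : Type) [Field L] [NumberField L] [IsCMField L] (H : Matrix (Fin 3) (Fin 3) L),
    (H.map (cmConjRingHom L))ᵀ = H → H.det ≠ 0 →
    ∀ (v : HeightOneSpectrum (𝓞 ↥(maximalRealSubfield L)))
      [MeasurableSpace ((UnitaryGroup.cmDatum L 3 H).Local v)] [BorelSpace ((UnitaryGroup.cmDatum L 3 H).Local v)]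
      (μ : Measure ((UnitaryGroup.cmDatum L 3 H).Local v)) [μ.IsHaarMeasure]
      (c : IrrClass ((UnitaryGroup.cmDatum L 3 H).Local v)),
      (∀ w : PlacesOver L v, IsCMField.complexConj L • w.1 = w.1) → c.IsSupercuspidal →
      ∀ s : (UnitaryGroup.cmDatum L 3 H).Local v, Module.End.IsSemisimple (Matrix.toLin' ((s.val : GL (Fin 3) (UnitaryGroup.LocalRing L v)).val : Matrix (Fin 3) (Fin 3) (UnitaryGroup.LocalRing L v))) →
        ∃ U : Set ((UnitaryGroup.cmDatum L 3 H).Local v), IsOpen U ∧ s ∈ U ∧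
          ∃ Θ : (UnitaryGroup.cmDatum L 3 H).Local v → ℂ, IntegrableOn Θ U μ ∧
            ∀ f : (UnitaryGroup.cmDatum L 3 H).Local v → ℂ, f ∈ SchwartzBruhat ((UnitaryGroup.cmDatum L 3 H).Local v) → tsupport f ⊆ U →
              c.smoothTrace μ f = ∫ g, f g * Θ g ∂μ := by
  intro L _ _ _ H hH hdet v _ _ μ _ c hns hc
  obtain ⟨r, hr, hsc, -, B, hBsymm, hBpos, hBinv⟩ :=
    K2E3CharLocIntNearSemisimpleSupercuspidalOfTruncated.exists_rep_data_of_isSupercuspidal L 3 H hH hdet v hns c hc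
  haveI : r.ρ.IsIrreducible := r.isIrreducible
  haveI : Nontrivial r.V := Representation.IsIrreducible.nontrivial r.ρ
  obtain ⟨v₁, hv₁⟩ := exists_ne (0 : r.V)
  obtain ⟨Ω, F, M, hlim, hdom, hM⟩ :=
    K2E3SupercuspidalTruncatedCharAnalyticOfEllWeightPlace.sigSCan_datum_of_ellWeightPlace L H hEW hH hdet v hns μ r hsc B hBinv v₁
  exact K2E3CharLocIntNearSemisimpleSupercuspidalOfTruncated.charLocIntNearSemisimple_supercuspidal_of_exists_truncated L 3 H hH hdet v hns μ c
    ⟨r, hr, hsc, B, hBsymm, hBpos, hBinv, v₁, hv₁, Ω, F, M, hlim, hdom, hM⟩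

end Summit.HodgeConjecture.HodgeConjecture.Cruxes.H413.K2E3CharLocIntNearSemisimpleSupercuspidalThree

end
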